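import Literature.Geometry.Lorentzian.InitialDataPullback
import Literature.Geometry.Lorentzian.Basic
import Literature.Geometry.Lorentzian.ChartSecondFundamentalForm
import Literature.Geometry.Lorentzian.MetricNormSq
import Literature.Geometry.Lorentzian.Genericity
import Mathlib.Analysis.Calculus.BumpFunction.FiniteDimension
import Mathlib.Analysis.SpecialFunctions.Log.Basic
import HarnessLib

/-!
# Smooth families of constraint solutions through a given solution on a chart domain

(trunk G08 = T-LORENTZ; family `gr`; namespaces `Literature.Geometry.Lorentzian.OpensChart`,
`Literature.Geometry.Lorentzian.InitialDataSet.Deformation`.)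

Let `U` be an open subset of `E3 = ℝ³` and `D = (h, k)` an initial data set on `U` solving the
vacuum constraints. This file constructs, through `D`, a **smooth injective `3`-parameter family
of solutions of the vacuum constraints** `F : ℝ³ → InitialDataSet 𝓘(ℝ, E3) U`, `F 0 = D`
(`InitialDataSet.exists_smoothFamily_constraints`), by pulling `D` back along a `3`-parameter
family of diffeomorphisms of `U` supported near a point `y₀` (diffeomorphism equivariance of the
constraint map, Bartnik–Isenberg 2004, §2; `InitialDataPullback.lean`):

  `φ_c(y) = y + ρ(y) (A(c) − 1)(y − y₀)`,  `A(c) = ∑ᵢ exp(c̃ᵢ) Pᵢ`,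

where `ρ` is a smooth bump function equal to `1` near `y₀` and supported in a small ball inside
`U`, `Pᵢ` are the projections onto an `h(y₀)`-orthogonal basis `bᵢ` of `ℝ³`, and
`c̃ = κ c / √(1 + |c|²)` is a bounded injective reparametrisation with `κ` so small that every
`φ_c` maps `U` into `U` with injective differentials. Since `φ_c(y₀) = y₀` and `Dφ_c(y₀) = A(c)`,
the pulled-back metric at `y₀` has `(φ_c^* h)_{y₀}(bᵢ, bᵢ) = exp(2c̃ᵢ) h_{y₀}(bᵢ, bᵢ)`, which
makes `c ↦ φ_c^* D` injective; `φ_0 = id` gives `F 0 = D`; joint smoothness in `(c, y)` is read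
off in the (identity) trivialisations of the chart domain.

This is the (folklore) local non-rigidity of the underdetermined-elliptic constraint system used
by the *shape-only* codimension clause of the vendored Dafermos–Holzegel–Rodnianski–Taylor
statement `dhrt_schwarzschild_codim3_stability` (`Stability.lean`, gr.S06; the clause records
Christodoulou's notion of finite codimension, `Genericity.lean`). Also proved here, for data on
chart domains: the mean curvature `tr_h k` is smooth (`OpensChart.contMDiff_traceK`, the
hypothesis of `momentumConstraintFn_comap_apply`).

Everything is proved; the definitions are the explicit maps of the construction; no named facts.

## References

* R. Bartnik, J. Isenberg, *The constraint equations* (2004), §2 (key `BartnikIsenberg2004`).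
* D. Christodoulou, *On the global initial value problem and the issue of singularities*, CQG 16
  (1999) A23, p. A24 (finite-codimension families of data).
* B. O'Neill, *Semi-Riemannian geometry* (1983), Ch. 3, pp. 90–91.
-/

noncomputable section

-- instance search through nested operator types (as in `ChartCurvature`)
set_option maxSynthPendingDepth 3

open Bundle Set Function Filter Manifold TopologicalSpace Module Metric
open scoped Manifold ContDiff Topology

namespace Literature.Geometry.Lorentzian

/-! ### Data on chart domains: representatives, smoothness of the mean curvature -/

namespace OpensChart

variable {E : Type*} [NormedAddCommGroup E] [NormedSpace ℝ E] [FiniteDimensional ℝ E]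
  [CompleteSpace E] {U : Opens E}

/-- The scalar product of data on a chart domain at `y`, read as a bilinear form on the model
space (`T_y U = E` definitionally). [folklore] -/
def innerE (D : InitialDataSet 𝓘(ℝ, E) U) (y : U) : E →L[ℝ] E →L[ℝ] ℝ :=
  show TangentSpace 𝓘(ℝ, E) y →L[ℝ] TangentSpace 𝓘(ℝ, E) y →L[ℝ] ℝ from D.h.inner y

/-- The tensor `k` of data on a chart domain at `y`, read on the model space. [folklore] -/
def kE (D : InitialDataSet 𝓘(ℝ, E) U) (y : U) : E →L[ℝ] E →L[ℝ] ℝ :=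
  show TangentSpace 𝓘(ℝ, E) y →L[ℝ] TangentSpace 𝓘(ℝ, E) y →L[ℝ] ℝ from D.k y

omit [FiniteDimensional ℝ E] [CompleteSpace E] in
/-- `innerE D y v w = h_y(v, w)`. [folklore] -/
@[simp]
theorem innerE_apply (D : InitialDataSet 𝓘(ℝ, E) U) (y : U) (v w : E) :
    innerE D y v w = D.h.inner y v w := rfl

omit [FiniteDimensional ℝ E] [CompleteSpace E] in
/-- `kE D y v w = k_y(v, w)`. [folklore] -/
@[simp]
theorem kE_apply (D : InitialDataSet 𝓘(ℝ, E) U) (y : U) (v w : E) : kE D y v w = D.k y v w := rfl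

omit [FiniteDimensional ℝ E] [CompleteSpace E] in
/-- The scalar product of data on a chart domain, as a map into the normed space of bilinear
forms, is smooth (the bundle of bilinear forms over `U` is trivialised by the identity,
`contMDiffAt_bilinSection_iff`). [folklore] -/
theorem contMDiff_innerE (D : InitialDataSet 𝓘(ℝ, E) U) :
    ContMDiff 𝓘(ℝ, E) 𝓘(ℝ, E →L[ℝ] E →L[ℝ] ℝ) ∞ (innerE D) := by
  classical
  intro x
  set G : E → E →L[ℝ] E →L[ℝ] ℝ := fun z ↦ if hz : z ∈ U then innerE D ⟨z, hz⟩ else 0 with hG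
  have hrep : ∀ y : U, D.h.inner y = G y := fun y ↦ by simp [hG, y.2]; rfl
  have h := (contMDiffAt_bilinSection_iff x D.h.inner G hrep).1 (D.h.contMDiff x)
  exact (contMDiffAt_iff x (innerE D) G hrep).2 h

omit [FiniteDimensional ℝ E] [CompleteSpace E] in
/-- The tensor `k` of data on a chart domain, as a map into the normed space of bilinear forms,
is smooth. [folklore] -/
theorem contMDiff_kE (D : InitialDataSet 𝓘(ℝ, E) U) :
    ContMDiff 𝓘(ℝ, E) 𝓘(ℝ, E →L[ℝ] E →L[ℝ] ℝ) ∞ (kE D) := by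
  classical
  intro x
  set G : E → E →L[ℝ] E →L[ℝ] ℝ := fun z ↦ if hz : z ∈ U then kE D ⟨z, hz⟩ else 0 with hG
  have hrep : ∀ y : U, D.k y = G y := fun y ↦ by simp [hG, y.2]; rfl
  have h := (contMDiffAt_bilinSection_iff x D.k G hrep).1 (D.contMDiff_k x)
  exact (contMDiffAt_iff x (kE D) G hrep).2 h

omit [CompleteSpace E] in
/-- The scalar product of data at a point, `v ↦ h_y(v, ·)`, is an invertible continuous linear
map `E →L (E →L ℝ)` (injective by positivity, between spaces of the same finite dimension).
[folklore] -/
theorem isInvertible_innerE (D : InitialDataSet 𝓘(ℝ, E) U) (y : U) : (innerE D y).IsInvertible := by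
  have hinj : Function.Injective (innerE D y) := by
    refine (injective_iff_map_eq_zero _).2 fun v hv ↦ ?_
    by_contra h0
    have hpos := D.h.pos y v h0
    have : innerE D y v v = 0 := by rw [hv]; rfl
    exact hpos.ne' this
  have hdim : Module.finrank ℝ E = Module.finrank ℝ (E →L[ℝ] ℝ) := by
    rw [← (LinearMap.toContinuousLinearMap (𝕜 := ℝ) (E := E) (F' := ℝ)).finrank_eq,
      Subspace.dual_finrank_eq]
  set e : E ≃ₗ[ℝ] (E →L[ℝ] ℝ) :=
    LinearMap.linearEquivOfInjective (innerE D y).toLinearMap hinj hdim with he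
  refine ⟨e.toContinuousLinearEquiv, ?_⟩
  ext v w
  rfl

omit [CompleteSpace E] in
/-- **The mean curvature through the inverse scalar product**: `tr_h k (y) = tr (h_y⁻¹ ∘ k_y)`,
`h_y⁻¹` the inverse of the continuous linear map `v ↦ h_y(v, ·)` (which is index raising).
O'Neill 1983, Ch. 3, pp. 60–61. [cite: ONeill1983, Ch. 3, pp. 60–61] -/
theorem traceK_eq_trace_inverse_comp (D : InitialDataSet 𝓘(ℝ, E) U) (y : U) :
    D.traceK y = LinearMap.trace ℝ E ((innerE D y).inverse.comp (kE D y)).toLinearMap := by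
  have hinv := isInvertible_innerE D y
  rw [InitialDataSet.traceK, PseudoRiemannianMetric.trace]
  congr 1
  refine LinearMap.ext fun v ↦ ?_
  rw [LinearMap.comp_apply, LinearEquiv.coe_coe]
  refine PseudoRiemannianMetric.sharp_eq_of_forall _ y _ _ fun w ↦ ?_
  change innerE D y ((innerE D y).inverse (kE D y v)) w = kE D y v w
  rw [hinv.self_apply_inverse]

/-- The trace of an endomorphism of the (finite-dimensional) model space, as a continuous linear
functional on `E →L E`. [folklore] -/
def traceCLM : (E →L[ℝ] E) →L[ℝ] ℝ :=
  LinearMap.toContinuousLinearMap ((LinearMap.trace ℝ E).comp (ContinuousLinearMap.coeLM ℝ))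

omit [CompleteSpace E] in
/-- `traceCLM A = tr A`. [folklore] -/
@[simp]
theorem traceCLM_apply (A : E →L[ℝ] E) : traceCLM A = LinearMap.trace ℝ E A.toLinearMap := rfl

/-- **The mean curvature of data on a chart domain is smooth**: `tr_h k = tr (h⁻¹ ∘ k)` with
`h`, `k` smooth maps into the normed spaces of forms and inversion smooth at invertible maps
(`ContinuousLinearMap.IsInvertible.contDiffAt_map_inverse`). This is the differentiability
hypothesis of `InitialDataSet.momentumConstraintFn_comap_apply`. [folklore] -/
theorem contMDiff_traceK (D : InitialDataSet 𝓘(ℝ, E) U) :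
    ContMDiff 𝓘(ℝ, E) 𝓘(ℝ, ℝ) ∞ D.traceK := by
  have hfun : D.traceK = fun y ↦ traceCLM ((innerE D y).inverse.comp (kE D y)) := by
    funext y
    rw [traceK_eq_trace_inverse_comp, traceCLM_apply]
  rw [hfun]
  intro y
  have hinvs : ContMDiffAt 𝓘(ℝ, E) 𝓘(ℝ, (E →L[ℝ] ℝ) →L[ℝ] E) ∞
      (fun y : U ↦ (innerE D y).inverse) y :=
    ContDiffAt.comp_contMDiffAt (isInvertible_innerE D y).contDiffAt_map_inverse
      (contMDiff_innerE D y)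
  have hcomp := hinvs.clm_comp (contMDiff_kE D y)
  exact traceCLM.contDiff.contDiffAt.comp_contMDiffAt hcomp

/-- The mean curvature of data on a chart domain is differentiable everywhere. [folklore] -/
theorem mdifferentiableAt_traceK (D : InitialDataSet 𝓘(ℝ, E) U) (y : U) :
    MDifferentiableAt 𝓘(ℝ, E) 𝓘(ℝ, ℝ) D.traceK y :=
  (contMDiff_traceK D y).mdifferentiableAt (by simp)

end OpensChart

/-! ### The deformation maps `φ_c(y) = y + ρ(y)(A(c) − 1)(y − y₀)` -/

namespace Deformation

/-- The parameter space `ℝ³` of the families (`EuclideanSpace ℝ (Fin 3)`, as in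
`InitialDataSet.IsSmoothDataFamily 3`). [folklore] -/
abbrev P3 : Type := EuclideanSpace ℝ (Fin 3)

/-! #### The bounded injective reparametrisation `c̃ = κ c / √(1 + |c|²)` -/

/-- The bounded reparametrisation `c̃ᵢ(c) = κ cᵢ / √(1 + |c|²)`. [folklore] -/
def squash (κ : ℝ) (c : P3) (i : Fin 3) : ℝ := κ * c i / √(1 + ‖c‖ ^ 2)

/-- `c̃(0) = 0`. [folklore] -/
@[simp]
theorem squash_zero (κ : ℝ) (i : Fin 3) : squash κ 0 i = 0 := by simp [squash]

/-- `|c̃ᵢ(c)| ≤ |κ|` (`|cᵢ| ≤ |c| ≤ √(1 + |c|²)`). [folklore] -/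
theorem abs_squash_le (κ : ℝ) (c : P3) (i : Fin 3) : |squash κ c i| ≤ |κ| := by
  have h1 : |c i| ≤ ‖c‖ := by
    have := PiLp.norm_apply_le (p := 2) c i
    simpa using this
  have h2 : ‖c‖ ≤ √(1 + ‖c‖ ^ 2) := by
    rw [Real.le_sqrt (norm_nonneg _) (by positivity)]
    nlinarith
  have hpos : 0 < √(1 + ‖c‖ ^ 2) := Real.sqrt_pos.2 (by positivity)
  rw [squash, abs_div, abs_mul, abs_of_pos hpos, div_le_iff₀ hpos]
  calc |κ| * |c i| ≤ |κ| * √(1 + ‖c‖ ^ 2) :=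
        mul_le_mul_of_nonneg_left (h1.trans h2) (abs_nonneg κ)
    _ = |κ| * √(1 + ‖c‖ ^ 2) := rfl

/-- `c ↦ c̃ᵢ(c)` is smooth. [folklore] -/
theorem contDiff_squash (κ : ℝ) (i : Fin 3) : ContDiff ℝ ∞ (fun c : P3 ↦ squash κ c i) := by
  unfold squash
  refine ContDiff.div ?_ ?_ fun c ↦ (Real.sqrt_pos.2 (by positivity)).ne'
  · exact contDiff_const.mul ((EuclideanSpace.proj (𝕜 := ℝ) i).contDiff)
  · exact (contDiff_const.add (contDiff_norm_sq ℝ)).sqrt fun c ↦ (by positivity : (1 + ‖c‖ ^ 2) ≠ 0)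

/-- **`c ↦ c̃(c)` is injective** for `κ ≠ 0`: `c/√(1+|c|²) = c'/√(1+|c'|²)` forces `|c| = |c'|`
and then `c = c'`. [folklore] -/
theorem squash_injective {κ : ℝ} (hκ : κ ≠ 0) {c c' : P3} (h : ∀ i, squash κ c i = squash κ c' i) :
    c = c' := by
  set s := √(1 + ‖c‖ ^ 2) with hs
  set s' := √(1 + ‖c'‖ ^ 2) with hs'
  have hspos : 0 < s := Real.sqrt_pos.2 (by positivity)
  have hs'pos : 0 < s' := Real.sqrt_pos.2 (by positivity)
  have hs2 : s ^ 2 = 1 + ‖c‖ ^ 2 := Real.sq_sqrt (by positivity)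
  have hs'2 : s' ^ 2 = 1 + ‖c'‖ ^ 2 := Real.sq_sqrt (by positivity)
  -- `cᵢ s' = c'ᵢ s`
  have hi : ∀ i, c i * s' = c' i * s := fun i ↦ by
    have := h i
    rw [squash, squash, div_eq_div_iff hspos.ne' hs'pos.ne'] at this
    have h3 : κ * (c i * s') = κ * (c' i * s) := by linarith
    exact mul_left_cancel₀ hκ h3
  -- `|c|² s'² = |c'|² s²`, hence `|c| = |c'|` and `s = s'`
  have hn : ‖c‖ ^ 2 = ∑ i, c i ^ 2 := by
    rw [EuclideanSpace.norm_sq_eq]; simp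
  have hn' : ‖c'‖ ^ 2 = ∑ i, c' i ^ 2 := by
    rw [EuclideanSpace.norm_sq_eq]; simp
  have hsum : ‖c‖ ^ 2 * s' ^ 2 = ‖c'‖ ^ 2 * s ^ 2 := by
    rw [hn, hn', Finset.sum_mul, Finset.sum_mul]
    refine Finset.sum_congr rfl fun i _ ↦ ?_
    have := hi i
    calc c i ^ 2 * s' ^ 2 = (c i * s') ^ 2 := by ring
      _ = (c' i * s) ^ 2 := by rw [this]
      _ = c' i ^ 2 * s ^ 2 := by ring
  rw [hs2, hs'2] at hsum
  have hnorm : ‖c‖ ^ 2 = ‖c'‖ ^ 2 := by nlinarith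
  have hss : s = s' := by rw [hs, hs', hnorm]
  ext i
  have := hi i
  rw [hss] at this
  exact mul_right_cancel₀ hs'pos.ne' this

/-! #### `|eˣ − 1| ≤ e^{|x|} − 1` -/

/-- `|exp x − 1| ≤ exp |x| − 1`. [folklore] -/
theorem abs_exp_sub_one_le_exp_abs_sub_one (x : ℝ) : |Real.exp x - 1| ≤ Real.exp |x| - 1 := by
  rcases le_or_gt 0 x with hx | hx
  · have h1 : 1 ≤ Real.exp x := Real.one_le_exp_iff.2 hx
    rw [abs_of_nonneg hx, abs_of_nonneg (by linarith)]
  · have h1 : Real.exp x ≤ 1 := Real.exp_le_one_iff.2 hx.le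
    rw [abs_of_neg hx, abs_of_nonpos (by linarith)]
    -- `2 ≤ exp x + exp (−x)`
    have h2 : x + 1 ≤ Real.exp x := Real.add_one_le_exp x
    have h3 : -x + 1 ≤ Real.exp (-x) := Real.add_one_le_exp (-x)
    linarith

/-! #### Projections on an orthogonal frame and the linear maps `A(c) = ∑ exp(c̃ᵢ) Pᵢ` -/

section Frame

variable (B : E3 →L[ℝ] E3 →L[ℝ] ℝ) (b : Module.Basis (Fin 3) ℝ E3)

/-- The projection `Pᵢ v = (B(bᵢ, v)/B(bᵢ, bᵢ)) bᵢ` onto the `i`-th vector of a `B`-orthogonal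
basis. [folklore] -/
def proj (i : Fin 3) : E3 →L[ℝ] E3 := ((B (b i) (b i))⁻¹ • B (b i)).smulRight (b i)

/-- `Pᵢ v = (B(bᵢ, v)/B(bᵢ, bᵢ)) bᵢ`. [folklore] -/
@[simp]
theorem proj_apply (i : Fin 3) (v : E3) : proj B b i v = ((B (b i) (b i))⁻¹ * B (b i) v) • b i := by
  simp [proj, ContinuousLinearMap.smulRight_apply, smul_eq_mul]

variable {B b} (hB : ∀ v w, B v w = B w v) (hb : B.toLinearMap₁₂.IsOrthoᵢ b)
  (hd : ∀ i, B (b i) (b i) ≠ 0)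

include hb hd in
/-- On the basis: `Pᵢ bⱼ = δᵢⱼ bⱼ`. [folklore] -/
theorem proj_basis (i j : Fin 3) : proj B b i (b j) = if i = j then b j else 0 := by
  rw [proj_apply]
  by_cases hij : i = j
  · subst hij
    rw [inv_mul_cancel₀ (hd i), one_smul, if_pos rfl]
  · have h0 : B (b i) (b j) = 0 := hb hij
    rw [h0, mul_zero, zero_smul, if_neg hij]

include hB hb hd in
/-- **Completeness of the frame**: `∑ᵢ Pᵢ = 1` (expansion of a vector in an orthogonal basis of
non-null vectors, `repr_eq_div_of_isOrthoᵢ`). [folklore] -/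
theorem sum_proj_apply (v : E3) : ∑ i, proj B b i v = v := by
  conv_rhs => rw [← b.sum_repr v]
  refine Finset.sum_congr rfl fun i _ ↦ ?_
  rw [proj_apply, repr_eq_div_of_isOrthoᵢ b hb hd v i]
  congr 1
  change (B (b i) (b i))⁻¹ * B (b i) v = B v (b i) / B (b i) (b i)
  rw [hB (b i) v, div_eq_inv_mul]

/-- The linear maps `A(c) = ∑ᵢ exp(c̃ᵢ(c)) Pᵢ`. [folklore] -/
def Amap (κ : ℝ) (c : P3) : E3 →L[ℝ] E3 := ∑ i, Real.exp (squash κ c i) • proj B b i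

include hB hb hd in
/-- `A(0) = 1`. [folklore] -/
theorem Amap_zero (κ : ℝ) : Amap (B := B) (b := b) κ 0 = 1 := by
  refine ContinuousLinearMap.ext fun v ↦ ?_
  simp only [Amap, squash_zero, Real.exp_zero, one_smul, FunLike.coe_sum, Finset.sum_apply,
    one_apply_eq_self]
  exact sum_proj_apply hB hb hd v

include hb hd in
/-- On the basis: `A(c) bⱼ = exp(c̃ⱼ(c)) bⱼ`. [folklore] -/
theorem Amap_basis (κ : ℝ) (c : P3) (j : Fin 3) :
    Amap (B := B) (b := b) κ c (b j) = Real.exp (squash κ c j) • b j := by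
  simp only [Amap, FunLike.coe_sum, Finset.sum_apply, FunLike.coe_smul, Pi.smul_apply,
    proj_basis hb hd, smul_ite, smul_zero, Finset.sum_ite_eq', Finset.mem_univ, if_true]

include hB hb hd in
/-- `A(c) − 1 = ∑ᵢ (exp(c̃ᵢ) − 1) Pᵢ`. [folklore] -/
theorem Amap_sub_one (κ : ℝ) (c : P3) :
    Amap (B := B) (b := b) κ c - 1 = ∑ i, (Real.exp (squash κ c i) - 1) • proj B b i := by
  refine ContinuousLinearMap.ext fun v ↦ ?_
  simp only [Amap, sub_apply, FunLike.coe_sum, Finset.sum_apply, FunLike.coe_smul, Pi.smul_apply,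
    one_apply_eq_self, sub_smul, one_smul, Finset.sum_sub_distrib, sum_proj_apply hB hb hd v]

include hB hb hd in
/-- **Uniform smallness of `A(c) − 1`**: `‖A(c) − 1‖ ≤ (exp |κ| − 1) ∑ᵢ ‖Pᵢ‖` for all `c`.
[folklore] -/
theorem norm_Amap_sub_one_le (κ : ℝ) (c : P3) :
    ‖Amap (B := B) (b := b) κ c - 1‖ ≤ (Real.exp |κ| - 1) * ∑ i, ‖proj B b i‖ := by
  rw [Amap_sub_one hB hb hd, Finset.mul_sum]
  refine (norm_sum_le _ _).trans (Finset.sum_le_sum fun i _ ↦ ?_)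
  rw [norm_smul]
  refine mul_le_mul_of_nonneg_right ?_ (norm_nonneg _)
  rw [Real.norm_eq_abs]
  refine (abs_exp_sub_one_le_exp_abs_sub_one _).trans ?_
  have := abs_squash_le κ c i
  have hmono := Real.exp_le_exp.2 this
  linarith

/-- `c ↦ A(c)` is smooth (into the normed space of continuous linear maps). [folklore] -/
theorem contDiff_Amap (κ : ℝ) : ContDiff ℝ ∞ (fun c : P3 ↦ Amap (B := B) (b := b) κ c) := by
  unfold Amap
  refine ContDiff.sum fun i _ ↦ ?_
  exact ((contDiff_squash κ i).exp).smul contDiff_const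

end Frame

/-! #### The deformation map `φ(y) = y + ρ(y)(A − 1)(y − y₀)` -/

/-- The deformation map `defMap y₀ ρ A y = y + ρ(y) (A − 1)(y − y₀)`. [folklore] -/
def defMap (y₀ : E3) (ρ : E3 → ℝ) (A : E3 →L[ℝ] E3) (y : E3) : E3 := y + ρ y • (A - 1) (y - y₀)

/-- For `A = 1` the deformation map is the identity. [folklore] -/
theorem defMap_one (y₀ : E3) (ρ : E3 → ℝ) : defMap y₀ ρ 1 = id := by
  funext y; simp [defMap]

/-- The deformation map fixes `y₀`. [folklore] -/
@[simp]
theorem defMap_self (y₀ : E3) (ρ : E3 → ℝ) (A : E3 →L[ℝ] E3) : defMap y₀ ρ A y₀ = y₀ := by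
  simp [defMap]

/-- Where `ρ` vanishes the deformation map is the identity. [folklore] -/
theorem defMap_of_eq_zero {y₀ : E3} {ρ : E3 → ℝ} (A : E3 →L[ℝ] E3) {y : E3} (hy : ρ y = 0) :
    defMap y₀ ρ A y = y := by
  simp [defMap, hy]

/-- Distance moved: `‖φ(y) − y‖ ≤ |ρ(y)| ‖A − 1‖ ‖y − y₀‖`. [folklore] -/
theorem norm_defMap_sub_le (y₀ : E3) (ρ : E3 → ℝ) (A : E3 →L[ℝ] E3) (y : E3) :
    ‖defMap y₀ ρ A y - y‖ ≤ |ρ y| * ‖A - 1‖ * ‖y - y₀‖ := by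
  rw [defMap, add_sub_cancel_left, norm_smul, Real.norm_eq_abs, mul_assoc]
  exact mul_le_mul_of_nonneg_left ((A - 1).le_opNorm _) (abs_nonneg _)

/-- **The derivative of the deformation map**:
`Dφ(y) = 1 + ρ(y) (A − 1) + Dρ(y) ⊗ (A − 1)(y − y₀)`. [folklore] -/
theorem hasFDerivAt_defMap (y₀ : E3) {ρ : E3 → ℝ} {ρ' : E3 →L[ℝ] ℝ} {y : E3}
    (hρ : HasFDerivAt ρ ρ' y) (A : E3 →L[ℝ] E3) :
    HasFDerivAt (defMap y₀ ρ A) (1 + (ρ y • (A - 1) + ρ'.smulRight ((A - 1) (y - y₀)))) y := by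
  have h1 : HasFDerivAt (fun y : E3 ↦ (A - 1) (y - y₀)) (A - 1) y := by
    have h := ((A - 1).hasFDerivAt (x := y - y₀)).comp y ((hasFDerivAt_id y).sub_const y₀)
    rw [ContinuousLinearMap.comp_id] at h
    exact h
  have h := (hasFDerivAt_id y).add (hρ.smul h1)
  refine h.congr_fderiv ?_
  ext v
  simp [ContinuousLinearMap.smulRight_apply]

/-- Norm bound for the perturbation in `Dφ(y) = 1 + T`:
`‖T‖ ≤ |ρ(y)| ‖A − 1‖ + ‖Dρ(y)‖ ‖A − 1‖ ‖y − y₀‖`. [folklore] -/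
theorem norm_fderiv_defMap_sub_one_le (y₀ : E3) (ρ : E3 → ℝ) (ρ' : E3 →L[ℝ] ℝ) (A : E3 →L[ℝ] E3)
    (y : E3) : ‖ρ y • (A - 1) + ρ'.smulRight ((A - 1) (y - y₀))‖ ≤
      |ρ y| * ‖A - 1‖ + ‖ρ'‖ * (‖A - 1‖ * ‖y - y₀‖) := by
  refine (norm_add_le _ _).trans (add_le_add ?_ ?_)
  · rw [norm_smul, Real.norm_eq_abs]
  · rw [ContinuousLinearMap.norm_smulRight_apply]
    exact mul_le_mul_of_nonneg_left ((A - 1).le_opNorm _) (norm_nonneg _)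

/-- A continuous linear map `1 + T` with `‖T‖ ≤ 1/2` is injective (`‖(1+T)v‖ ≥ ‖v‖/2`).
[folklore] -/
theorem injective_one_add_of_norm_le {T : E3 →L[ℝ] E3} (hT : ‖T‖ ≤ 1 / 2) :
    Function.Injective (1 + T : E3 →L[ℝ] E3) := by
  refine (injective_iff_map_eq_zero _).2 fun v hv ↦ ?_
  have h1 : ‖T v‖ ≤ 1 / 2 * ‖v‖ := (T.le_opNorm v).trans (mul_le_mul_of_nonneg_right hT (norm_nonneg _))
  have h2 : v = -T v := by
    have : v + T v = 0 := by simpa using hv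
    exact eq_neg_of_add_eq_zero_left this
  have h3 : ‖v‖ = ‖T v‖ := by rw [h2, norm_neg, ← h2]
  have h4 : ‖v‖ ≤ 0 := by nlinarith [norm_nonneg v]
  exact norm_le_zero_iff.1 h4

/-- **Joint smoothness of the deformation maps** `(c, y) ↦ φ_c(y)` for a smooth bump `ρ` and
the smooth family `A(c)`. [folklore] -/
theorem contDiff_defMap_family {B : E3 →L[ℝ] E3 →L[ℝ] ℝ} {b : Module.Basis (Fin 3) ℝ E3}
    (y₀ : E3) {ρ : E3 → ℝ} (hρ : ContDiff ℝ ∞ ρ) (κ : ℝ) :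
    ContDiff ℝ ∞ (fun q : P3 × E3 ↦ defMap y₀ ρ (Amap (B := B) (b := b) κ q.1) q.2) := by
  unfold defMap
  refine contDiff_snd.add ((hρ.comp contDiff_snd).smul ?_)
  have hA : ContDiff ℝ ∞ (fun q : P3 × E3 ↦ Amap (B := B) (b := b) κ q.1 - 1) :=
    ((contDiff_Amap (B := B) (b := b) κ).comp contDiff_fst).sub contDiff_const
  exact hA.clm_apply (contDiff_snd.sub contDiff_const)

/-! ### The family of pulled-back data through `D` -/

/-- The bump function of the construction: `= 1` on `closedBall y₀ δ`, supported in
`ball y₀ (2δ)`. [folklore] -/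
def bump (y₀ : E3) {δ : ℝ} (hδ : 0 < δ) : ContDiffBump y₀ := ⟨δ, 2 * δ, hδ, by linarith⟩

section Family

variable {U : Opens E3} (D : InitialDataSet 𝓘(ℝ, E3) U) (y₀ : U) {δ : ℝ} (hδ : 0 < δ)
  (b : Module.Basis (Fin 3) ℝ E3) (κ : ℝ)

/-- The deformation maps of the construction as functions on `E3`:
`Φ̂_c(y) = y + ρ(y)(A(c) − 1)(y − y₀)` with `A(c)` built on the frame `b` and the scalar product
`h(y₀)`. [folklore] -/
def defFun (c : P3) (y : E3) : E3 :=
  defMap (y₀ : E3) (bump (y₀ : E3) hδ) (Amap (B := OpensChart.innerE D y₀) (b := b) κ c) y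

variable {D y₀ hδ b κ}
  (hb : (OpensChart.innerE D y₀).toLinearMap₁₂.IsOrthoᵢ b)
  (hU : closedBall (y₀ : E3) (3 * δ) ⊆ U) {C : ℝ} (hC0 : 0 ≤ C)
  (hC : ∀ y, ‖fderiv ℝ (bump (y₀ : E3) hδ : E3 → ℝ) y‖ ≤ C)
  (hκ : (Real.exp |κ| - 1) * (∑ i, ‖proj (OpensChart.innerE D y₀) b i‖) * (1 + C * (2 * δ)) ≤ 1 / 4)

/-- The scalar product `h(y₀)` is symmetric. [folklore] -/
theorem innerE_symm (v w : E3) : OpensChart.innerE D y₀ v w = OpensChart.innerE D y₀ w v :=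
  D.h.symm y₀ v w

/-- The frame vectors are non-null for `h(y₀)` (positivity). [folklore] -/
theorem innerE_basis_ne_zero (i : Fin 3) : OpensChart.innerE D y₀ (b i) (b i) ≠ 0 :=
  (D.h.pos y₀ (b i) (b.ne_zero i)).ne'

include hδ hb hC0 hκ in
/-- The two smallness consequences of the choice of `κ`: with `L = (exp|κ| − 1) ∑‖Pᵢ‖`,
`‖A(c) − 1‖ ≤ L ≤ 1/4` and `L C (2δ) ≤ 1/4`. [folklore] -/
theorem smallness (c : P3) :
    ‖Amap (B := OpensChart.innerE D y₀) (b := b) κ c - 1‖ ≤ 1 / 4 ∧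
      ‖Amap (B := OpensChart.innerE D y₀) (b := b) κ c - 1‖ * (C * (2 * δ)) ≤ 1 / 4 := by
  set L := (Real.exp |κ| - 1) * ∑ i, ‖proj (OpensChart.innerE D y₀) b i‖ with hL
  have hA : ‖Amap (B := OpensChart.innerE D y₀) (b := b) κ c - 1‖ ≤ L :=
    norm_Amap_sub_one_le (innerE_symm (D := D) (y₀ := y₀)) hb innerE_basis_ne_zero κ c
  have hL0 : 0 ≤ L := by
    have h1 : 0 ≤ Real.exp |κ| - 1 := by linarith [Real.one_le_exp_iff.2 (abs_nonneg κ)]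
    positivity
  have hδ0 : 0 ≤ C * (2 * δ) := by have := hδ.le; positivity
  have h1 : L ≤ 1 / 4 := by nlinarith
  have h2 : L * (C * (2 * δ)) ≤ 1 / 4 := by nlinarith
  exact ⟨hA.trans h1, (mul_le_mul_of_nonneg_right hA hδ0).trans h2⟩

include hb hU hC0 hκ in
/-- **The deformation maps preserve `U`**: where `ρ ≠ 0` the point moves by less than `δ`
inside `ball y₀ (2δ)`, landing in `closedBall y₀ (3δ) ⊆ U`. [folklore] -/
theorem defFun_mem (c : P3) (y : U) : defFun D y₀ hδ b κ c y ∈ U := by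
  by_cases hρ : (bump (y₀ : E3) hδ : E3 → ℝ) y = 0
  · rw [defFun, defMap_of_eq_zero _ hρ]; exact y.2
  · -- `y ∈ ball y₀ (2δ)`
    have hy : (y : E3) ∈ ball (y₀ : E3) (2 * δ) := by
      have : (y : E3) ∈ Function.support (bump (y₀ : E3) hδ : E3 → ℝ) := hρ
      rwa [ContDiffBump.support_eq] at this
    refine hU (mem_closedBall.2 ?_)
    have hmove := norm_defMap_sub_le (y₀ : E3) (bump (y₀ : E3) hδ)
      (Amap (B := OpensChart.innerE D y₀) (b := b) κ c) y
    have hρ1 : |(bump (y₀ : E3) hδ : E3 → ℝ) y| ≤ 1 := by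
      rw [abs_of_nonneg (ContDiffBump.nonneg _)]; exact ContDiffBump.le_one _
    have hA := (smallness (hδ := hδ) hb hC0 hκ c).1
    rw [mem_ball, dist_eq_norm] at hy
    rw [dist_eq_norm, defFun]
    have : ‖defMap (↑y₀) (⇑(bump (↑y₀) hδ)) (Amap (B := OpensChart.innerE D y₀) (b := b) κ c) ↑y - ↑y‖
        ≤ 1 * (1 / 4) * ‖(y : E3) - y₀‖ := by
      refine hmove.trans ?_
      gcongr
    calc ‖defMap (↑y₀) (⇑(bump (↑y₀) hδ)) (Amap (B := OpensChart.innerE D y₀) (b := b) κ c) ↑y - ↑y₀‖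
        ≤ ‖defMap (↑y₀) (⇑(bump (↑y₀) hδ)) (Amap (B := OpensChart.innerE D y₀) (b := b) κ c) ↑y - ↑y‖
            + ‖(y : E3) - y₀‖ := norm_sub_le_norm_sub_add_norm_sub _ _ _
      _ ≤ 1 * (1 / 4) * ‖(y : E3) - y₀‖ + ‖(y : E3) - y₀‖ := by gcongr
      _ ≤ 3 * δ := by nlinarith

include hb hC0 hC hκ in
/-- **The deformation maps have injective differentials** (`Dφ = 1 + T`, `‖T‖ ≤ 1/2`). [folklore] -/
theorem injective_fderiv_defFun (c : P3) (y : E3) :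
    Function.Injective (fderiv ℝ (defFun D y₀ hδ b κ c) y) := by
  set A := Amap (B := OpensChart.innerE D y₀) (b := b) κ c with hA
  set ρ : E3 → ℝ := ⇑(bump (y₀ : E3) hδ) with hρ
  have hρd : HasFDerivAt ρ (fderiv ℝ ρ y) y :=
    (((bump (y₀ : E3) hδ).contDiff (n := ⊤)).differentiable (by simp) y).hasFDerivAt
  have hder := hasFDerivAt_defMap (y₀ : E3) hρd A
  rw [show defFun D y₀ hδ b κ c = defMap (y₀ : E3) ρ A from rfl, hder.fderiv]
  refine injective_one_add_of_norm_le ?_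
  obtain ⟨h1, h2⟩ := smallness (hδ := hδ) hb hC0 hκ c
  refine (norm_fderiv_defMap_sub_one_le (y₀ : E3) ρ (fderiv ℝ ρ y) A y).trans ?_
  by_cases hy : y ∈ closedBall (y₀ : E3) (2 * δ)
  · have hρ1 : |ρ y| ≤ 1 := by
      rw [abs_of_nonneg (ContDiffBump.nonneg _)]; exact ContDiffBump.le_one _
    rw [mem_closedBall, dist_eq_norm] at hy
    have hT2 : ‖fderiv ℝ ρ y‖ * (‖A - 1‖ * ‖y - ↑y₀‖) ≤ C * (‖A - 1‖ * (2 * δ)) := by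
      gcongr
      exact hC y
    calc |ρ y| * ‖A - 1‖ + ‖fderiv ℝ ρ y‖ * (‖A - 1‖ * ‖y - ↑y₀‖)
        ≤ 1 * (1 / 4) + C * (‖A - 1‖ * (2 * δ)) := by gcongr
      _ ≤ 1 / 2 := by nlinarith
  · -- outside the support everything vanishes
    have hnot : y ∉ tsupport ρ := by
      rw [hρ, tsupport, ContDiffBump.support_eq]
      show y ∉ closure (ball (y₀ : E3) (2 * δ))
      rw [closure_ball _ (by linarith : (2 * δ) ≠ 0)]
      exact hy
    have hρ0 : ρ y = 0 := image_eq_zero_of_notMem_tsupport hnot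
    have hdρ0 : fderiv ℝ ρ y = 0 :=
      image_eq_zero_of_notMem_tsupport fun h ↦ hnot (tsupport_fderiv_subset ℝ h)
    rw [hρ0, hdρ0]
    simp

variable (D y₀ hδ b κ) in
/-- The deformation maps as self-maps of the chart domain `U`. [folklore] -/
def phi (hmem : ∀ c (y : U), defFun D y₀ hδ b κ c y ∈ U) (c : P3) (y : U) : U :=
  ⟨defFun D y₀ hδ b κ c y, hmem c y⟩

/-- The representative of `phi`. [folklore] -/
@[simp]
theorem coe_phi (hmem : ∀ c (y : U), defFun D y₀ hδ b κ c y ∈ U) (c : P3) (y : U) :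
    (phi D y₀ hδ b κ hmem c y : E3) = defFun D y₀ hδ b κ c y := rfl

/-- `(c, y) ↦ Φ̂_c(y)` is smooth. [folklore] -/
theorem contDiff_defFun : ContDiff ℝ ∞ (fun q : P3 × E3 ↦ defFun D y₀ hδ b κ q.1 q.2) :=
  contDiff_defMap_family (B := OpensChart.innerE D y₀) (b := b) (y₀ : E3)
    (bump (y₀ : E3) hδ).contDiff κ

/-- Each `Φ̂_c` is smooth. [folklore] -/
theorem contDiff_defFun_right (c : P3) : ContDiff ℝ ∞ (defFun D y₀ hδ b κ c) := by
  unfold defFun defMap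
  exact contDiff_id.add (((bump (y₀ : E3) hδ).contDiff (n := ⊤)).smul
    ((Amap (B := OpensChart.innerE D y₀) (b := b) κ c - 1).contDiff.comp
      (contDiff_id.sub contDiff_const)))

/-- Each `φ_c : U → U` is smooth (`C^{∞+1} = C^∞`). [folklore] -/
theorem contMDiff_phi (hmem : ∀ c (y : U), defFun D y₀ hδ b κ c y ∈ U) (c : P3) :
    ContMDiff 𝓘(ℝ, E3) 𝓘(ℝ, E3) (∞ + 1) (phi D y₀ hδ b κ hmem c) := fun y ↦
  (ChartedSpace.liftPropWithinAt_subtypeVal_comp_iff (phi D y₀ hδ b κ hmem c) Set.univ y).mp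
    ((((contDiff_defFun_right c).contMDiff).comp contMDiff_subtype_val) y)

/-- The differential of `φ_c` is the Fréchet derivative of `Φ̂_c`. [folklore] -/
theorem mfderiv_phi_apply (hmem : ∀ c (y : U), defFun D y₀ hδ b κ c y ∈ U) (c : P3) (y : U)
    (v : E3) :
    mfderiv 𝓘(ℝ, E3) 𝓘(ℝ, E3) (phi D y₀ hδ b κ hmem c) y v = fderiv ℝ (defFun D y₀ hδ b κ c) y v :=
  OpensChart.mfderiv_apply_of_repr (f := phi D y₀ hδ b κ hmem c) (fun _ ↦ rfl)
    (((contDiff_defFun_right (D := D) (y₀ := y₀) (hδ := hδ) (b := b) (κ := κ) c).differentiable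
      (by simp)) _) v

include hb hC0 hC hκ in
/-- The differentials of `φ_c` are injective. [folklore] -/
theorem injective_mfderiv_phi (hmem : ∀ c (y : U), defFun D y₀ hδ b κ c y ∈ U) (c : P3) (y : U) :
    Function.Injective (mfderiv 𝓘(ℝ, E3) 𝓘(ℝ, E3) (phi D y₀ hδ b κ hmem c) y) := by
  intro v w hvw
  have h : fderiv ℝ (defFun D y₀ hδ b κ c) y v = fderiv ℝ (defFun D y₀ hδ b κ c) y w := by
    rw [← mfderiv_phi_apply hmem c y v, ← mfderiv_phi_apply hmem c y w]
    exact hvw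
  exact injective_fderiv_defFun hb hC0 hC hκ c y h

variable (D y₀ hδ b κ) in
/-- **The family** `F(c) = φ_c^* D` of pulled-back data. [cite: BartnikIsenberg2004, §2] -/
abbrev family (hmem : ∀ c (y : U), defFun D y₀ hδ b κ c y ∈ U)
    (hinj : ∀ c (y : U), Function.Injective (mfderiv 𝓘(ℝ, E3) 𝓘(ℝ, E3) (phi D y₀ hδ b κ hmem c) y))
    (c : P3) : InitialDataSet 𝓘(ℝ, E3) U :=
  D.comap (phi D y₀ hδ b κ hmem c) (contMDiff_phi hmem c) (hinj c)

variable {hmem : ∀ c (y : U), defFun D y₀ hδ b κ c y ∈ U}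
  {hinj : ∀ c (y : U), Function.Injective (mfderiv 𝓘(ℝ, E3) 𝓘(ℝ, E3) (phi D y₀ hδ b κ hmem c) y)}

include hb in
/-- `φ_0 = id` (`A(0) = 1`). [folklore] -/
theorem phi_zero : phi D y₀ hδ b κ hmem 0 = id := by
  funext y
  apply Subtype.ext
  rw [coe_phi, defFun, Amap_zero (innerE_symm (D := D) (y₀ := y₀)) hb innerE_basis_ne_zero,
    defMap_one]
  rfl

include hb in
/-- **`F(0) = D`.** [cite: BartnikIsenberg2004, §2] -/
theorem family_zero : family D y₀ hδ b κ hmem hinj 0 = D :=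
  D.comap_eq_self_of_eq_id _ _ (phi_zero hb)

/-- **Every member of the family solves the vacuum constraints if `D` does** (diffeomorphism
equivariance, `isVacuumConstraintSolution_comap`, with the smoothness of the mean curvature on
chart domains, `OpensChart.mdifferentiableAt_traceK`). [cite: BartnikIsenberg2004, §2] -/
theorem family_isVacuumConstraintSolution [D.metric.HasLeviCivita] (hD : D.IsVacuumConstraintSolution)
    (c : P3) [(family D y₀ hδ b κ hmem hinj c).metric.HasLeviCivita] :
    (family D y₀ hδ b κ hmem hinj c).IsVacuumConstraintSolution :=
  D.isVacuumConstraintSolution_comap _ _ rfl hD (OpensChart.mdifferentiableAt_traceK D)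

/-! #### Injectivity in the parameter -/

/-- At the centre: `Dφ_c(y₀) = A(c)` (`ρ ≡ 1` near `y₀`). [folklore] -/
theorem fderiv_defFun_self (c : P3) (v : E3) :
    fderiv ℝ (defFun D y₀ hδ b κ c) y₀ v = Amap (B := OpensChart.innerE D y₀) (b := b) κ c v := by
  set ρ : E3 → ℝ := ⇑(bump (y₀ : E3) hδ) with hρ
  have hρd : HasFDerivAt ρ (fderiv ℝ ρ y₀) y₀ :=
    (((bump (y₀ : E3) hδ).contDiff (n := ⊤)).differentiable (by simp) _).hasFDerivAt
  have hder := hasFDerivAt_defMap (y₀ : E3) hρd (Amap (B := OpensChart.innerE D y₀) (b := b) κ c)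
  have hρ1 : ρ y₀ = 1 := (bump (y₀ : E3) hδ).one_of_mem_closedBall (mem_closedBall_self hδ.le)
  rw [show defFun D y₀ hδ b κ c = defMap (y₀ : E3) ρ _ from rfl, hder.fderiv]
  simp [hρ1]

include hb in
/-- **The pulled-back metric at the centre, on the frame**:
`(φ_c^* h)_{y₀}(bᵢ, bᵢ) = exp(c̃ᵢ(c))² h_{y₀}(bᵢ, bᵢ)`. [folklore] -/
theorem family_inner_self_basis (c : P3) (i : Fin 3) :
    (family D y₀ hδ b κ hmem hinj c).h.inner y₀ (b i) (b i) =
      Real.exp (squash κ c i) ^ 2 * OpensChart.innerE D y₀ (b i) (b i) := by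
  have hpt : phi D y₀ hδ b κ hmem c y₀ = y₀ := Subtype.ext (by simp [defFun])
  have key : ∀ v w : E3, D.h.inner (phi D y₀ hδ b κ hmem c y₀) v w = D.h.inner y₀ v w :=
    fun v w ↦ by rw [hpt]
  rw [family, InitialDataSet.comap_h_inner, mfderiv_phi_apply, fderiv_defFun_self,
    Amap_basis hb innerE_basis_ne_zero, key]
  change OpensChart.innerE D y₀ (Real.exp (squash κ c i) • b i) (Real.exp (squash κ c i) • b i) = _
  rw [map_smul, map_smul, smul_apply, smul_eq_mul, smul_eq_mul]
  ring

include hb in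
/-- **The family is injective** (for `κ ≠ 0`): read `exp(2c̃ᵢ)` off the pulled-back metric at
the centre, then invert the reparametrisation. [folklore] -/
theorem family_injective (hκ0 : κ ≠ 0) : Function.Injective (family D y₀ hδ b κ hmem hinj) := by
  intro c c' hcc
  refine squash_injective hκ0 fun i ↦ ?_
  have h := family_inner_self_basis (hmem := hmem) (hinj := hinj) hb c i
  rw [hcc, family_inner_self_basis (hmem := hmem) (hinj := hinj) hb c' i] at h
  have hd : OpensChart.innerE D y₀ (b i) (b i) ≠ 0 := innerE_basis_ne_zero i
  have h2 : Real.exp (squash κ c' i) ^ 2 = Real.exp (squash κ c i) ^ 2 := mul_right_cancel₀ hd h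
  have h3 : Real.exp (squash κ c' i) = Real.exp (squash κ c i) := by
    nlinarith [Real.exp_pos (squash κ c' i), Real.exp_pos (squash κ c i)]
  exact (Real.exp_injective h3).symm

/-! #### Joint smoothness in the parameter and the point -/

/-- **Smooth dependence of pulled-back sections on `(c, y)`**: for a smooth section `s` of the
bundle of bilinear forms over `U` with representative `S`, the map
`(c, y) ↦ (φ_c^* s)_y` is a smooth map `ℝ³ × U → Hom(TU, Hom(TU, ℝ))` over `(c, y) ↦ y`. In
the identity trivialisations of the chart domain this is the smoothness of
`(c, y) ↦ (DΦ̂_c(y))ᵀ S(Φ̂_c(y)) DΦ̂_c(y)`, a composite of smooth maps (`ContDiffAt.fderiv` for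
the parametric derivative). [folklore] -/
theorem contMDiff_pullback_family
    {s : Π y : U, TangentSpace 𝓘(ℝ, E3) y →L[ℝ] TangentSpace 𝓘(ℝ, E3) y →L[ℝ] ℝ}
    {S : E3 → E3 →L[ℝ] E3 →L[ℝ] ℝ} (hs : ∀ y : U, s y = S y) (hS : ∀ y : U, ContDiffAt ℝ ∞ S y) :
    ContMDiff (𝓘(ℝ, P3).prod 𝓘(ℝ, E3)) (𝓘(ℝ, E3).prod 𝓘(ℝ, E3 →L[ℝ] E3 →L[ℝ] ℝ)) ∞
      (fun p : P3 × U ↦ TotalSpace.mk' (E3 →L[ℝ] E3 →L[ℝ] ℝ)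
        (E := fun y : U ↦ TangentSpace 𝓘(ℝ, E3) y →L[ℝ] TangentSpace 𝓘(ℝ, E3) y →L[ℝ] ℝ) p.2
        (pullbackBilin (I := 𝓘(ℝ, E3)) (I' := 𝓘(ℝ, E3)) (phi D y₀ hδ b κ hmem p.1) s p.2)) := by
  intro p₀
  rw [contMDiffAt_bilin_iff]
  refine ⟨contMDiffAt_snd, ?_⟩
  -- the trivialisation of `TU` at `p₀.2` is the identity on fibres
  have hsymm : ∀ (z : U) (v : E3),
      (trivializationAt E3 (TangentSpace 𝓘(ℝ, E3) : U → Type _) p₀.2).symmL ℝ z v = v := by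
    intro z v
    rw [Trivialization.symmL_apply _ (by simp [OpensChart.chartAt_source])]
    exact OpensChart.trivializationAt_symm_apply p₀.2 z v
  -- the smooth representative on `P3 × E3`
  set g : P3 × E3 → E3 →L[ℝ] E3 →L[ℝ] ℝ := fun q ↦
    (ContinuousLinearMap.precomp ℝ (fderiv ℝ (defFun D y₀ hδ b κ q.1) q.2)).comp
      ((S (defFun D y₀ hδ b κ q.1 q.2)).comp (fderiv ℝ (defFun D y₀ hδ b κ q.1) q.2)) with hg
  have hfun : (fun x : P3 × U ↦ (ContinuousLinearMap.precomp ℝ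
      ((trivializationAt E3 (TangentSpace 𝓘(ℝ, E3) : U → Type _) p₀.2).symmL ℝ x.2)).comp
        ((pullbackBilin (I := 𝓘(ℝ, E3)) (I' := 𝓘(ℝ, E3)) (phi D y₀ hδ b κ hmem x.1) s x.2).comp
          ((trivializationAt E3 (TangentSpace 𝓘(ℝ, E3) : U → Type _) p₀.2).symmL ℝ x.2))) =
      fun x ↦ g (x.1, (x.2 : E3)) := by
    funext x
    ext v w
    simp only [hg, ContinuousLinearMap.comp_apply, ContinuousLinearMap.precomp_apply,
      pullbackBilin_apply, hsymm, mfderiv_phi_apply, hs, coe_phi]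
    rfl
  rw [hfun]
  -- smoothness of `g` at `(p₀.1, p₀.2)`
  have hF := contDiff_defFun (D := D) (y₀ := y₀) (hδ := hδ) (b := b) (κ := κ)
  have hA' : ContDiffAt ℝ ∞ (fun q : P3 × E3 ↦ fderiv ℝ (defFun D y₀ hδ b κ q.1) q.2)
      (p₀.1, (p₀.2 : E3)) := by
    have hunc : ContDiffAt ℝ ∞ (Function.uncurry fun (q : P3 × E3) (y : E3) ↦ defFun D y₀ hδ b κ q.1 y)
        ((p₀.1, (p₀.2 : E3)), (p₀.2 : E3)) :=
      (hF.comp ((contDiff_fst.comp contDiff_fst).prodMk contDiff_snd)).contDiffAt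
    exact hunc.fderiv (contDiffAt_snd (𝕜 := ℝ)) le_rfl
  have hmem0 : defFun D y₀ hδ b κ p₀.1 p₀.2 ∈ U := hmem p₀.1 p₀.2
  have hSΦ : ContDiffAt ℝ ∞ (fun q : P3 × E3 ↦ S (defFun D y₀ hδ b κ q.1 q.2)) (p₀.1, (p₀.2 : E3)) :=
    ContDiffAt.comp (p₀.1, (p₀.2 : E3)) (hS ⟨_, hmem0⟩) hF.contDiffAt
  have hpre : ContDiffAt ℝ ∞ (fun q : P3 × E3 ↦
      ContinuousLinearMap.precomp ℝ (fderiv ℝ (defFun D y₀ hδ b κ q.1) q.2) :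
        P3 × E3 → (E3 →L[ℝ] ℝ) →L[ℝ] E3 →L[ℝ] ℝ) (p₀.1, (p₀.2 : E3)) := by
    have heq : (fun q : P3 × E3 ↦ (ContinuousLinearMap.precomp ℝ (fderiv ℝ (defFun D y₀ hδ b κ q.1) q.2) :
        (E3 →L[ℝ] ℝ) →L[ℝ] E3 →L[ℝ] ℝ)) =
        fun q ↦ (ContinuousLinearMap.compL ℝ E3 E3 ℝ).flip (fderiv ℝ (defFun D y₀ hδ b κ q.1) q.2) := by
      funext q; ext f v; rfl
    rw [heq]
    exact (ContinuousLinearMap.compL ℝ E3 E3 ℝ).flip.contDiff.contDiffAt.comp _ hA'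
  have hgs : ContDiffAt ℝ ∞ g (p₀.1, (p₀.2 : E3)) := hpre.clm_comp (hSΦ.clm_comp hA')
  have hι : ContMDiffAt (𝓘(ℝ, P3).prod 𝓘(ℝ, E3)) 𝓘(ℝ, P3 × E3) ∞
      (fun x : P3 × U ↦ (x.1, (x.2 : E3))) p₀ :=
    contMDiffAt_fst.prodMk_space (contMDiff_subtype_val.contMDiffAt.comp p₀ contMDiffAt_snd)
  exact ContDiffAt.comp_contMDiffAt (f := fun x : P3 × U ↦ (x.1, (x.2 : E3))) (x := p₀) hgs hι

/-- **The family is a smooth `3`-parameter family of data** (`IsSmoothDataFamily 3`).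
[folklore] -/
theorem isSmoothDataFamily_family :
    InitialDataSet.IsSmoothDataFamily 3 (family D y₀ hδ b κ hmem hinj) := by
  classical
  -- smooth representatives of `h` and `k`
  set G : E3 → E3 →L[ℝ] E3 →L[ℝ] ℝ := fun z ↦ if hz : z ∈ U then OpensChart.innerE D ⟨z, hz⟩ else 0
    with hG
  have hGrep : ∀ y : U, D.h.inner y = G y := fun y ↦ by simp [hG, y.2]; rfl
  have hGs : ∀ y : U, ContDiffAt ℝ ∞ G y := fun y ↦
    (OpensChart.contMDiffAt_bilinSection_iff y D.h.inner G hGrep).1 (D.h.contMDiff y)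
  set K : E3 → E3 →L[ℝ] E3 →L[ℝ] ℝ := fun z ↦ if hz : z ∈ U then OpensChart.kE D ⟨z, hz⟩ else 0
    with hK
  have hKrep : ∀ y : U, D.k y = K y := fun y ↦ by simp [hK, y.2]; rfl
  have hKs : ∀ y : U, ContDiffAt ℝ ∞ K y := fun y ↦
    (OpensChart.contMDiffAt_bilinSection_iff y D.k K hKrep).1 (D.contMDiff_k y)
  exact ⟨contMDiff_pullback_family (hmem := hmem) hGrep hGs, contMDiff_pullback_family (hmem := hmem) hKrep hKs⟩

end Family

/-! ### Existence of the parameters; the main theorem -/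

/-- Reindexing preserves orthogonality of a family. [folklore] -/
theorem isOrthoᵢ_reindex {ι ι' : Type*} {B' : LinearMap.BilinForm ℝ E3} (b : Module.Basis ι ℝ E3)
    (e : ι ≃ ι') (hb : B'.IsOrthoᵢ b) : B'.IsOrthoᵢ (b.reindex e) := by
  intro i j hij
  simp only [Function.onFun, Module.Basis.reindex_apply]
  exact hb fun h ↦ hij (e.symm.injective h)

/-- **Through every solution of the vacuum constraints on a chart domain of `ℝ³` passes a
smooth injective `3`-parameter family of solutions** (`IsSmoothDataFamily 3`, `F 0 = D`,
`F` injective; pullbacks along the deformation maps `φ_c`). Bartnik–Isenberg 2004, §2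
(diffeomorphism equivariance); Christodoulou 1999, p. A24 (families of data).
[cite: BartnikIsenberg2004, §2] -/
theorem exists_family {U : Opens E3} (D : InitialDataSet 𝓘(ℝ, E3) U) [D.metric.HasLeviCivita]
    (hD : D.IsVacuumConstraintSolution) (y₀ : U) :
    ∃ F : P3 → InitialDataSet 𝓘(ℝ, E3) U, InitialDataSet.IsSmoothDataFamily 3 F ∧ F 0 = D ∧
      Function.Injective F ∧ ∀ c, ∀ [(F c).metric.HasLeviCivita], (F c).IsVacuumConstraintSolution := by
  -- a ball around `y₀` inside `U`
  obtain ⟨ε, hε, hεU⟩ := Metric.isOpen_iff.1 U.isOpen (y₀ : E3) y₀.2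
  set δ := ε / 4 with hδdef
  have hδ : 0 < δ := by positivity
  have hU : closedBall (y₀ : E3) (3 * δ) ⊆ U := fun z hz ↦ hεU (mem_ball.2 (by
    have := mem_closedBall.1 hz; linarith))
  -- an `h(y₀)`-orthogonal frame
  have hsymm : LinearMap.IsSymm (OpensChart.innerE D y₀).toLinearMap₁₂ :=
    LinearMap.isSymm_def.2 fun v w ↦ by simpa using D.h.symm y₀ v w
  obtain ⟨b₀, hb₀⟩ := LinearMap.BilinForm.exists_orthogonal_basis hsymm
  set b : Module.Basis (Fin 3) ℝ E3 := b₀.reindex (finCongr finrank_euclideanSpace_fin) with hbdef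
  have hb : (OpensChart.innerE D y₀).toLinearMap₁₂.IsOrthoᵢ b := isOrthoᵢ_reindex b₀ _ hb₀
  -- a bound on the derivative of the bump
  set ρ := bump (y₀ : E3) hδ with hρ
  have hcont : Continuous fun y ↦ ‖fderiv ℝ (ρ : E3 → ℝ) y‖ :=
    ((ρ.contDiff (n := ⊤)).continuous_fderiv (by simp)).norm
  have hsupp : HasCompactSupport fun y ↦ ‖fderiv ℝ (ρ : E3 → ℝ) y‖ :=
    (ρ.hasCompactSupport.fderiv ℝ).norm
  obtain ⟨C₀, hC₀⟩ := hcont.bddAbove_range_of_hasCompactSupport hsupp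
  set C := max C₀ 0 with hCdef
  have hC0 : 0 ≤ C := le_max_right _ _
  have hC : ∀ y, ‖fderiv ℝ (ρ : E3 → ℝ) y‖ ≤ C := fun y ↦
    (hC₀ ⟨y, rfl⟩).trans (le_max_left _ _)
  -- the choice of `κ`
  set S := ∑ i, ‖proj (OpensChart.innerE D y₀) b i‖ with hSdef
  have hS0 : 0 ≤ S := Finset.sum_nonneg fun i _ ↦ norm_nonneg _
  set t := (1 / 4) / ((S + 1) * (1 + C * (2 * δ))) with htdef
  have hden : 0 < (S + 1) * (1 + C * (2 * δ)) := by positivity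
  have ht : 0 < t := by positivity
  set κ := Real.log (1 + t) with hκdef
  have hκpos : 0 < κ := Real.log_pos (by linarith)
  have hexp : Real.exp |κ| - 1 = t := by
    rw [abs_of_pos hκpos, hκdef, Real.exp_log (by linarith)]; ring
  have hκ : (Real.exp |κ| - 1) * S * (1 + C * (2 * δ)) ≤ 1 / 4 := by
    rw [hexp, htdef]
    rw [div_mul_eq_mul_div, div_mul_eq_mul_div, div_le_iff₀ hden]
    nlinarith
  -- the family
  have hmem : ∀ c (y : U), defFun D y₀ hδ b κ c y ∈ U := defFun_mem hb hU hC0 hκ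
  have hinj := injective_mfderiv_phi hb hC0 hC hκ hmem
  refine ⟨family D y₀ hδ b κ hmem hinj, isSmoothDataFamily_family, family_zero hb,
    family_injective hb hκpos.ne', fun c _ ↦ family_isVacuumConstraintSolution hD c⟩

end Deformation


end Literature.Geometry.Lorentzian

end
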